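import Summits.CriticalPhenomena.CardyFormulaZ2.Theses.CardyLeeYang
import HarnessLib

/-!
# Birth skeleton for the crux `CardyLeeYang.PoissonBinomialLimits`
(item `stmt-CriticalPhenomena-16790`, route `route-CriticalPhenomena-CardyLeeYang`, sub-problem
`CardyFormulaZ2`; BC3 skeleton registered by the skeleton registrar, 2026-08-17)

The crux (filed as support, rank 9; load-bearing hypothesis `h_PoissonBinomialLimits` of the route's
`closes`): **PTAR ⇒ limit structure.** IF at every mesh `δ > 0` the number `N_R^δ` of open clusters
of the discrete domain `Ω_δ` (`openGraph ω ⊓ discreteDomainGraph R.carrier δ`) meeting both discrete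
arcs `(ab)_δ = discreteArc R.carrier δ (R.arc 0)` and `(cd)_δ = discreteArc R.carrier δ (R.arc 2)` is
Poisson-binomial — `P(N = k) = [X^k] ∏_{i<n} ((1 - p_i) + p_i X)`, `p_i ∈ [0,1]` — THEN along every
mesh sequence `s_j → 0⁺` some subsequence `s_{φ j}` has `P(N_R^{s_{φ j}} = k) → r_k` for every `k`,
where `r = PB(p)` is the Poisson-binomial law of a SUMMABLE parameter sequence `p ∈ [0,1]^ℕ`
(`r_k = lim_n [X^k] ∏_{i<n} ((1 - p_i) + p_i X)`), i.e. no mass escapes and NO POISSON FACTOR appears.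

## The line: Aizenman's Gaussian tail ‖ transfer to the G02 discretisation ‖ Laguerre–Pólya compactness

The informal proof on the item ("BK + RSW tightness, Hurwitz on the zero-free PGFs, Aizenman's
`e^{-αk²}` tail excludes a Poisson component") is cut into its three genuinely different parts:

* `stub_boxTail` — **Aizenman's theorem on lattice rectangles** (percolation on `ℤ²` at `p = 1/2`,
  no domain geometry): for every aspect bound `ρ` there are `C, α > 0` with
  `P_{1/2}(∃ k pairwise vertex-DISJOINT open left–right crossings of [0,m]×[0,n]) ≤ C e^{-αk²}` for
  all `m, n` with `n ≤ ρ m` and all `k` (Aizenman 1997, Thm. for `d = 2`: the number of disjoint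
  spanning paths has a Gaussian upper tail, uniformly in the size; independent columns of width
  `≍ n/k` × a large-deviation bound for the min-defect dual cut of one column; the lattice regime
  `k ≍ n` is a column-wise Chernoff bound).  Stated with DISJOINT PATHS (witness sets `S i`), which
  dominates the number of distinct crossing clusters and is what the transfer needs near rough
  boundary.  Size L.
* `stub_tailTransfer` — **box tail ⇒ domain tail** (`Sig.stub_tailTransfer := Sig.stub_boxTail →
  Sig.stub_domainTail`; planar geometry of the G02 discretisation, no new probability): for every
  conformal rectangle `R` there is `δ₀ > 0` such that the box tail gives
  `P(N_R^δ ≥ k) ≤ C e^{-αk²}` for all `δ ∈ (0, δ₀)` and all `k`.  Intended proof: a crosscut of `Ω`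
  from a point of the open arc `(bc)` to a point of `(da)` separates `(ab)_δ` from `(cd)_δ` for small
  `δ`; cover it by two boundary squares and finitely many interior squares; each of `k` distinct
  crossing clusters contains an open path meeting the crosscut, hence a short-direction crossing of
  one of `4(L+2)` fixed lattice rectangles of aspect `≤ 4` (square-annulus decomposition); distinct
  clusters give vertex-disjoint paths; pigeonhole + `stub_boxTail` at `ρ = 5` + lattice symmetries
  (`BondPercolationSymmetry`).  Size M–L (the G02 largest-component bookkeeping is the work).
* `stub_pbCompactness` — **pure analysis, no percolation**: a sequence `(q_j)` of finitely supported
  Poisson-binomial laws on `ℕ` whose point masses eventually satisfy a uniform Gaussian bound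
  `q_j(k) ≤ C e^{-αk²}` has a subsequence converging pointwise to `PB(p)` for a summable
  `p ∈ [0,1]^ℕ`, with `r_k = lim_n [X^k]∏_{i<n}` existing.  Intended proof: means are eventually
  bounded (`Σ_k k C e^{-αk²}`); decreasing rearrangement + diagonal extraction `p^{(φ j)}_i → p_i`
  (Tychonoff on `[0,1]^ℕ`), Fatou gives `Σ p_i ≤ lim μ_{φ j} =: μ`; the PGFs converge to
  `e^{λ(z-1)} ∏ (1 + p_i (z-1))` with `λ = μ - Σ p_i ≥ 0` (Hurwitz / Laguerre–Pólya closure of the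
  real-rooted class); the Gaussian bound passes to the limit and forces `λ = 0`, since a Poisson
  factor has tail `≫ e^{-λ} λ^k / k!`.  Size M.

The composition `PoissonBinomialLimits_of` is bookkeeping only (sorry-free): along a mesh sequence
`s_j → 0⁺`, PTAR at mesh `s_j` is the first hypothesis of `stub_pbCompactness` for
`q_j(k) = P(N ≥ k) - P(N ≥ k+1)`, and the domain tail (eventually `s_j < δ₀`) is the second, because
`q_j(k) ≤ P(N ≥ k)`.

Disproof used: none on file for this crux (`ledger crux ls stmt-CriticalPhenomena-16790`: no
workfiles, no `Disproof.lean`, no `Negative/` lemmas, 2026-08-17); `ledger negatives --problem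
CriticalPhenomena` has no statement about crossing numbers (route header, 2026-08-16).
-/

namespace Summit.CriticalPhenomena.CardyFormulaZ2.Cruxes.PoissonBinomialLimits.Birth

open scoped Classical
open Summit.CriticalPhenomena.CardyFormulaZ2.Theses.CardyLeeYang (PoissonBinomialLimits)

/-! ### Stub signatures (stated over existing declarations only; the `let` prefixes of
`Sig.stub_domainTail` are copied verbatim from the conclusion of the route decl) -/

/-- Signature of `stub_boxTail` — **Aizenman's Gaussian tail for disjoint crossings of lattice
rectangles** (bond percolation on `ℤ²`, `p = 1/2`): for every aspect bound `ρ > 0` there are `C` and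
`α > 0` such that for all `m n : ℕ` with `n ≤ ρ·m` and every `k`, the `P_{1/2}`-probability that
`[0,m]×[0,n]` contains `k` pairwise vertex-disjoint open left–right crossings — encoded by pairwise
disjoint witness sets `S i ⊆ rectangle m n`, each carrying an open path (`openConnIn (S i)`) from
`leftSide m n` to `rightSide m n` — is at most `C·exp(-α k²)`.  (For `k > n+1` the event is empty;
`k = 0` forces `C ≥ 1`.) [Aizenman1997, Thm. (2D spanning clusters); Grimmett1999 §11.3–11.7 (RSW,
BK); BollobasRiordan2006 Ch. 3] -/
def Sig.stub_boxTail : Prop :=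
  ∀ ρ : ℝ, 0 < ρ → ∃ C α : ℝ, 0 < α ∧ ∀ m n : ℕ, (n : ℝ) ≤ ρ * m → ∀ k : ℕ, (Literature.Probability.Percolation.bondPercolation (Literature.Probability.LatticeModels.zdGraph 2) Literature.Probability.Percolation.half).real {ω | ∃ S : Fin k → Set (Literature.Probability.LatticeModels.Site 2), (∀ i j, i ≠ j → Disjoint (S i) (S j)) ∧ ∀ i, S i ⊆ (Literature.Probability.Percolation.rectangle m n : Set (Literature.Probability.LatticeModels.Site 2)) ∧ ∃ x ∈ (Literature.Probability.Percolation.leftSide m n : Set (Literature.Probability.LatticeModels.Site 2)), ∃ z ∈ (Literature.Probability.Percolation.rightSide m n : Set (Literature.Probability.LatticeModels.Site 2)), ω ∈ Literature.Probability.Percolation.openConnIn (S i) x z} ≤ C * Real.exp (-(α * (k : ℝ) ^ 2))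

/-- Signature of the conclusion of `stub_tailTransfer` — **Gaussian tail of the crossing number of a
conformal rectangle under the G02 discretisation, uniformly in small mesh**: for every conformal
rectangle `R` there are `δ₀ > 0`, `C` and `α > 0` with `P_{1/2}(N_R^δ ≥ k) ≤ C·exp(-α k²)` for all
`δ ∈ (0, δ₀)` and all `k`, where `{N_R^δ ≥ k}` is the crux's own event `atLeast δ k` (k pairwise
`G_ω`-disconnected vertices of `(ab)_δ`, each `G_ω`-joined to `(cd)_δ`,
`G_ω = openGraph ω ⊓ discreteDomainGraph R.carrier δ`). [Aizenman1997; Smirnov2001 §2 (discretisation)] -/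
def Sig.stub_domainTail : Prop :=
  ∀ R : Literature.Probability.RandomPlanarGeometry.ConformalRectangle, let G : ℝ → Literature.Probability.Percolation.BondConfig (Literature.Probability.LatticeModels.Site 2) → SimpleGraph (Literature.Probability.LatticeModels.Site 2) := fun δ ω => Literature.Probability.Percolation.openGraph ω ⊓ Literature.Probability.LatticeModels.discreteDomainGraph R.carrier δ; let atLeast : ℝ → ℕ → Set (Literature.Probability.Percolation.BondConfig (Literature.Probability.LatticeModels.Site 2)) := fun δ k => {ω | ∃ x : Fin k → Literature.Probability.LatticeModels.Site 2, (∀ i, x i ∈ Literature.Probability.LatticeModels.discreteArc R.carrier δ (R.arc 0) ∧ ∃ y ∈ Literature.Probability.LatticeModels.discreteArc R.carrier δ (R.arc 2), (G δ ω).Reachable (x i) y) ∧ ∀ i j, i ≠ j → ¬ (G δ ω).Reachable (x i) (x j)}; ∃ δ₀ : ℝ, 0 < δ₀ ∧ ∃ C α : ℝ, 0 < α ∧ ∀ δ : ℝ, 0 < δ → δ < δ₀ → ∀ k : ℕ, (Literature.Probability.Percolation.bondPercolation (Literature.Probability.LatticeModels.zdGraph 2) Literature.Probability.Percolation.half).real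 (atLeast δ k) ≤ C * Real.exp (-(α * (k : ℝ) ^ 2))

/-- Signature of `stub_tailTransfer` — **box tail ⇒ domain tail** (the transfer, as a named
implication between the two signatures above; geometry of the G02 discretisation only: crosscut of `Ω`
from `(bc)` to `(da)`, two boundary squares + finitely many interior squares, square-annulus
decomposition into `4(L+2)` fixed lattice rectangles of aspect `≤ 4`, pigeonhole over the `k` distinct
crossing clusters — which give vertex-DISJOINT open paths —, `Sig.stub_boxTail` at `ρ = 5` and the
lattice symmetries of `P_{1/2}`). [Aizenman1997; Smirnov2001 §2; Grimmett1999 §11.7] -/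
def Sig.stub_tailTransfer : Prop :=
  Sig.stub_boxTail → Sig.stub_domainTail

/-- Signature of `stub_pbCompactness` — **Laguerre–Pólya compactness with a Gaussian tail (pure
analysis)**: a sequence `q : ℕ → (ℕ → ℝ)` of finitely supported Poisson-binomial laws
(`q j k = [X^k] ∏_{i<n_j} ((1 - p_i) + p_i X)`, `p_i ∈ [0,1]`) whose point masses eventually obey a
uniform bound `q j k ≤ C·exp(-α k²)` has a subsequence `q ∘ φ` converging pointwise to the
Poisson-binomial law `r` of a SUMMABLE parameter sequence `p ∈ [0,1]^ℕ`
(`r k = lim_n [X^k] ∏_{i<n} ((1 - p_i) + p_i X)`, these limits existing). The Gaussian bound is what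
excludes the Poisson factor `e^{λ(z-1)}` of the general closure `Poisson(λ) ∗ PB(p)` of the class.
[Branden2014 §2 (Laguerre–Pólya class); HeilmannLieb1972 (real-rooted PGFs); folklore: closure of
Poisson-binomial laws under weak convergence] -/
def Sig.stub_pbCompactness : Prop :=
  ∀ q : ℕ → ℕ → ℝ, (∀ j : ℕ, ∃ (n : ℕ) (p : Fin n → ℝ), (∀ i, 0 ≤ p i ∧ p i ≤ 1) ∧ ∀ k : ℕ, q j k = (∏ i, (Polynomial.C (1 - p i) + Polynomial.C (p i) * Polynomial.X)).coeff k) → (∃ C α : ℝ, 0 < α ∧ ∀ᶠ j : ℕ in Filter.atTop, ∀ k : ℕ, q j k ≤ C * Real.exp (-(α * (k : ℝ) ^ 2))) → ∃ φ : ℕ → ℕ, StrictMono φ ∧ ∃ (p r : ℕ → ℝ), (∀ i, 0 ≤ p i ∧ p i ≤ 1) ∧ Summable p ∧ (∀ k : ℕ, Filter.Tendsto (fun n : ℕ => (∏ i ∈ Finset.range n, (Polynomial.C (1 - p i) + Polynomial.C (p i) * Polynomial.X)).coeff k) Filter.atTop (nhds (r k))) ∧ ∀ k : ℕ, Filter.Tendsto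 (fun j : ℕ => q (φ j) k) Filter.atTop (nhds (r k))

/-! ### The stubs -/

/-- stub 1 — Aizenman's Gaussian tail for disjoint left–right crossings of lattice rectangles of
bounded aspect ratio at `p = 1/2` (classical; percolation on `ℤ²` only). -/
theorem stub_boxTail : Sig.stub_boxTail := by
  sorry

/-- stub 2 — transfer of the box tail to the crossing number of a conformal rectangle under the
G02 discretisation (crosscut + square-annulus pigeonhole + lattice symmetries; geometry only). -/
theorem stub_tailTransfer : Sig.stub_tailTransfer := by
  sorry

/-- stub 3 — Laguerre–Pólya compactness: Gaussian-tailed sequences of Poisson-binomial laws have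
Poisson-binomial (summable, Poisson-free) subsequential limits (analysis only). -/
theorem stub_pbCompactness : Sig.stub_pbCompactness := by
  sorry

/-! ### The composition (sorry-free): the three stubs give the crux BY NAME -/

/-- **`PoissonBinomialLimits` from the three stubs.**  Along a mesh sequence `s_j → 0⁺`, PTAR at mesh
`s_j` (the crux's own hypothesis) says that `q_j(k) = P(N ≥ k) - P(N ≥ k+1)` is a finitely supported
Poisson-binomial law; the domain tail (stub 2 fed with stub 1) bounds `q_j(k) ≤ P(N ≥ k) ≤ C e^{-αk²}`
as soon as `s_j < δ₀`, i.e. eventually; stub 3 then hands back the subsequence, the summable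
parameter sequence and the limits, literally in the shape of the crux's conclusion. -/
theorem PoissonBinomialLimits_of :
    Sig.stub_boxTail → Sig.stub_tailTransfer → Sig.stub_pbCompactness →
      Summit.CriticalPhenomena.CardyFormulaZ2.Theses.CardyLeeYang.PoissonBinomialLimits := by
  intro hBox hTransfer hPB
  dsimp only [Sig.stub_tailTransfer] at hTransfer
  have hDom : Sig.stub_domainTail := hTransfer hBox
  dsimp only [Sig.stub_pbCompactness] at hPB
  intro hPTAR R s hs_pos hs_lim G atLeast
  obtain ⟨δ₀, hδ₀, C, α, hα, hbound⟩ := hDom R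
  -- PTAR at mesh `s j`: the point masses of `N` are Poisson-binomial coefficients
  have hq : ∀ j : ℕ, ∃ (n : ℕ) (p : Fin n → ℝ), (∀ i, 0 ≤ p i ∧ p i ≤ 1) ∧ ∀ k : ℕ,
      (Literature.Probability.Percolation.bondPercolation (Literature.Probability.LatticeModels.zdGraph 2)
            Literature.Probability.Percolation.half).real (atLeast (s j) k) -
          (Literature.Probability.Percolation.bondPercolation (Literature.Probability.LatticeModels.zdGraph 2)
            Literature.Probability.Percolation.half).real (atLeast (s j) (k + 1)) =
        (∏ i, (Polynomial.C (1 - p i) + Polynomial.C (p i) * Polynomial.X)).coeff k :=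
    fun j => hPTAR R (s j) (hs_pos j)
  -- the Gaussian tail, eventually along the mesh sequence (`s j < δ₀` eventually since `s → 0`)
  have htail : ∃ C α : ℝ, 0 < α ∧ ∀ᶠ j : ℕ in Filter.atTop, ∀ k : ℕ,
      (Literature.Probability.Percolation.bondPercolation (Literature.Probability.LatticeModels.zdGraph 2)
            Literature.Probability.Percolation.half).real (atLeast (s j) k) -
          (Literature.Probability.Percolation.bondPercolation (Literature.Probability.LatticeModels.zdGraph 2)
            Literature.Probability.Percolation.half).real (atLeast (s j) (k + 1)) ≤
        C * Real.exp (-(α * (k : ℝ) ^ 2)) := by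
    refine ⟨C, α, hα, ?_⟩
    filter_upwards [hs_lim.eventually (eventually_lt_nhds hδ₀)] with j hj k
    exact (sub_le_self _ MeasureTheory.measureReal_nonneg).trans (hbound (s j) (hs_pos j) hj k)
  -- Laguerre–Pólya compactness along the sequence of laws
  exact hPB (fun j k =>
      (Literature.Probability.Percolation.bondPercolation (Literature.Probability.LatticeModels.zdGraph 2)
            Literature.Probability.Percolation.half).real (atLeast (s j) k) -
        (Literature.Probability.Percolation.bondPercolation (Literature.Probability.LatticeModels.zdGraph 2)
            Literature.Probability.Percolation.half).real (atLeast (s j) (k + 1))) hq htail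

end Summit.CriticalPhenomena.CardyFormulaZ2.Cruxes.PoissonBinomialLimits.Birth
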